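import Literature.NumberTheory.EllipticCurves.ModularSymbolsSubquotients
import Mathlib.NumberTheory.Padics.PadicIntegers
import HarnessLib

/-!
# Values of modular symbols: Manin's lemma in span form, boundedness, and change of scalars for `Sym⁰`

Three small algebraic complements to the `Symb` framework of `ModularSymbolsCoefficients`:

* **Manin's lemma in span form** (`modSym_apply_mem_of_unimodular`): every value `φ(x, y)` of an
  additive function of pairs of cusps lies in any additive subgroup containing the unimodular
  values `φ(g∞, g0)`, `g ∈ SL₂(ℤ)` (the continued-fraction induction of
  `ModularSymbolsManinGeneration.modSym_eq_zero_of_forall_unimodular`);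
* **boundedness** (`exists_norm_apply_le`, `exists_pow_mul_apply_norm_le_one`): a `Γ`-invariant
  `Sym⁰`-valued symbol (`Γ` of finite index) over `ℚ_p` takes its values in the subgroup generated
  by the FINITELY many unimodular values `φ(gᵢ∞, gᵢ0)` (`gᵢ` right-coset representatives), hence is
  bounded and becomes `ℤ_p`-valued after multiplication by a power of `p` — the bounded
  denominators of Mazur–Tate–Teitelbaum 1986, §I.8 in abstract form;
* **change of scalars for `Sym⁰`-valued symbols** (`mapZero`, `mapZero_mem_Symb_iff`,
  `hecke_mapZero`, `hecke_mapZero_eq_smul_iff`): along an injective ring homomorphism `σ : R → R'`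
  membership in `Symb_Γ(Sym⁰)` and the Hecke eigen-equations are reflected and preserved (the
  `Sym⁰`-action is by transport of the cusps only, `symPowOn_zero_slash`).

Everything is proved; no named facts.

## References

* Ju. I. Manin, Izv. Akad. Nauk SSSR 36 (1972), §1.6. [Manin1972]
* B. Mazur, J. Tate, J. Teitelbaum, Invent. Math. 84 (1986), §I.8. [MazurTateTeitelbaum1986Invent]
-/

noncomputable section

open scoped MatrixGroups
open Matrix CongruenceSubgroup

namespace Literature.NumberTheory.EllipticCurves

open ModularForms ModularForms.HidaCohomology P1Q

/-! ### Manin's lemma in span form -/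

section Span

variable {R V : Type*} [CommRing R] [AddCommGroup V] [Module R V]

/-- **Manin's lemma (span form)**: the values of an additive function of pairs of cusps lie in any
additive subgroup containing its unimodular values `φ(g∞, g0)`, `g ∈ SL₂(ℤ)`. [cite: Manin1972, §1.6] -/
theorem modSym_apply_mem_of_unimodular {φ : P1Q → P1Q → V} (hφ : φ ∈ modSym R V) (W : AddSubgroup V)
    (h : ∀ g : SL(2, ℤ), φ (act (g : Matrix (Fin 2) (Fin 2) ℤ) infty) (act (g : Matrix (Fin 2) (Fin 2) ℤ) (ofRat 0)) ∈ W)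
    (x y : P1Q) : φ x y ∈ W := by
  -- Step 1: `φ(∞, a/c) ∈ W` for coprime `a, c`, `c ≥ 1`, by strong induction on `c`.
  have key : ∀ (c : ℕ) (a : ℤ), 1 ≤ c → IsCoprime a (c : ℤ) → φ infty (ofRat ((a : ℚ) / (c : ℚ))) ∈ W := by
    intro c
    induction c using Nat.strong_induction_on with
    | _ c ih =>
      intro a hc hac
      rcases Nat.lt_or_ge c 2 with hc1 | hc2
      · have hc1' : c = 1 := by omega
        subst hc1'
        have hg := h (sl2 1 a 0 1 (by ring))
        rw [coe_sl2, mat2_act_infty_of_eq_zero (by norm_num), mat2_act_zero (by norm_num) one_ne_zero] at hg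
        simpa using hg
      · obtain ⟨b, d, hd0, hdc, hdet⟩ := exists_unimodular_step hc2 hac
        have hbd : IsCoprime b (d : ℤ) := ⟨-(c : ℤ), a, by linear_combination hdet⟩
        have ih' := ih d hdc b hd0 hbd
        have hg := h (sl2 a b c d hdet)
        have hc0 : (c : ℤ) ≠ 0 := by exact_mod_cast (by omega : c ≠ 0)
        have hd0' : (d : ℤ) ≠ 0 := by exact_mod_cast hd0.ne'
        rw [coe_sl2, mat2_act_infty (by rw [hdet]; exact one_ne_zero) hc0,
          mat2_act_zero (by rw [hdet]; exact one_ne_zero) hd0'] at hg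
        push_cast at hg ih' ⊢
        rw [← (mem_modSym_iff.mp hφ) infty (ofRat ((b : ℚ) / (d : ℚ))) (ofRat ((a : ℚ) / (c : ℚ))),
          modSym_swap hφ (ofRat ((a : ℚ) / (c : ℚ))) (ofRat ((b : ℚ) / (d : ℚ)))]
        exact W.add_mem ih' (W.neg_mem hg)
  -- Step 2: `φ(∞, y) ∈ W` for all `y`, and `φ(x, y) = -φ(∞, x) + φ(∞, y)`.
  have hinf : ∀ y, φ infty y ∈ W := fun y => by
    rcases infty_or_ofRat y with rfl | ⟨r, rfl⟩
    · rw [modSym_self hφ infty]; exact W.zero_mem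
    · obtain ⟨a, c, hc, hac, he⟩ := exists_coprime_eq_ofRat r
      rw [he]
      exact key c a hc hac
  rw [← (mem_modSym_iff.mp hφ) x infty y, modSym_swap hφ infty x]
  exact W.add_mem (W.neg_mem (hinf x)) (hinf y)

end Span

/-! ### `Sym⁰`: the action is transport of cusps -/

section SymZero

variable {S : Set (Matrix (Fin 2) (Fin 2) ℤ)} {R : Type*} [CommRing R]

/-- **The slash action of `Sym⁰` transports the cusps only.** [folklore] -/
theorem symPowOn_zero_slash (M : Matrix (Fin 2) (Fin 2) ℤ) (φ : P1Q → P1Q → (Fin 1 → R)) (x y : P1Q) :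
    (CoeffActionOn.symPowOn S 0 R).slash M φ x y = φ (act M x) (act M y) := by
  rw [CoeffActionOn.slash_apply]
  change act 0 M (φ (P1Q.act M x) (P1Q.act M y)) = _
  rw [act_zero_eq_id, LinearMap.id_apply]

/-- The unimodular values of a `Γ`-invariant `Sym⁰`-valued symbol are constant on right cosets `Γg`. [folklore] -/
theorem unimodular_value_const {Γ : Subgroup SL(2, ℤ)} {φ : P1Q → P1Q → (Fin 1 → R)}
    (hφ : φ ∈ (CoeffActionOn.symPowOn S 0 R).Symb Γ) {γ : SL(2, ℤ)} (hγ : γ ∈ Γ) (g : SL(2, ℤ)) :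
    φ (act ((γ * g : SL(2, ℤ)) : Matrix (Fin 2) (Fin 2) ℤ) infty) (act ((γ * g : SL(2, ℤ)) : Matrix (Fin 2) (Fin 2) ℤ) (ofRat 0)) =
      φ (act (g : Matrix (Fin 2) (Fin 2) ℤ) infty) (act (g : Matrix (Fin 2) (Fin 2) ℤ) (ofRat 0)) := by
  have h := congrFun (congrFun (hφ.2 γ hγ) (act (g : Matrix (Fin 2) (Fin 2) ℤ) infty)) (act (g : Matrix (Fin 2) (Fin 2) ℤ) (ofRat 0))
  rw [symPowOn_zero_slash, act_act (det_coe_sl_ne_zero' γ) (det_coe_sl_ne_zero' g),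
    act_act (det_coe_sl_ne_zero' γ) (det_coe_sl_ne_zero' g), ← Matrix.SpecialLinearGroup.coe_mul] at h
  exact h
where
  /-- `det g ≠ 0` for `g ∈ SL₂(ℤ)` (local copy). [folklore] -/
  det_coe_sl_ne_zero' (g : SL(2, ℤ)) : (g : Matrix (Fin 2) (Fin 2) ℤ).det ≠ 0 := by
    rw [Matrix.SpecialLinearGroup.det_coe]; exact one_ne_zero

/-- **The values of a `Γ`-invariant `Sym⁰`-valued symbol lie in the subgroup generated by the finitely
many unimodular values at right-coset representatives.** [cite: MazurTateTeitelbaum1986Invent, §I.8] -/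
theorem apply_mem_closure_unimodular {Γ : Subgroup SL(2, ℤ)} {φ : P1Q → P1Q → (Fin 1 → R)}
    (hφ : φ ∈ (CoeffActionOn.symPowOn S 0 R).Symb Γ) (x y : P1Q) :
    φ x y ∈ AddSubgroup.closure (Set.range fun i : Quotient (QuotientGroup.rightRel Γ) =>
      φ (act ((Quotient.out i : SL(2, ℤ)) : Matrix (Fin 2) (Fin 2) ℤ) infty)
        (act ((Quotient.out i : SL(2, ℤ)) : Matrix (Fin 2) (Fin 2) ℤ) (ofRat 0))) := by
  refine modSym_apply_mem_of_unimodular hφ.1 _ (fun g => ?_) x y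
  obtain ⟨i, γ, hγ, rfl⟩ := CoeffActionOn.cover_rightRel Γ g
  rw [unimodular_value_const hφ hγ]
  exact AddSubgroup.subset_closure ⟨i, rfl⟩

end SymZero

/-! ### Boundedness over `ℚ_p` -/

section Bounded

variable {p : ℕ} [Fact p.Prime] {S : Set (Matrix (Fin 2) (Fin 2) ℤ)}

/-- Elements of the subgroup generated by a set bounded by `C ≥ 0` are bounded by `C` (ultrametric). [folklore] -/
theorem norm_le_of_mem_closure {E : Type*} [SeminormedAddCommGroup E] [IsUltrametricDist E] {s : Set E} {C : ℝ} (hC : 0 ≤ C)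
    (hs : ∀ v ∈ s, ‖v‖ ≤ C) {v : E} (hv : v ∈ AddSubgroup.closure s) : ‖v‖ ≤ C := by
  induction hv using AddSubgroup.closure_induction with
  | mem v hv => exact hs v hv
  | zero => rw [norm_zero]; exact hC
  | add a b _ _ ha hb => exact (IsUltrametricDist.norm_add_le_max a b).trans (max_le ha hb)
  | neg a _ ha => rw [norm_neg]; exact ha

/-- The additive map `v ↦ v 0` carries the closure of the unimodular values to the closure of their `0`-th coordinates. [folklore] -/
theorem apply_zero_mem_closure {E : Type*} [AddCommGroup E] {s : Set (Fin 1 → E)} {v : Fin 1 → E} (hv : v ∈ AddSubgroup.closure s) :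
    v 0 ∈ AddSubgroup.closure ((fun w : Fin 1 → E => w 0) '' s) := by
  have h := AddSubgroup.mem_map_of_mem (Pi.evalAddMonoidHom (fun _ : Fin 1 => E) 0) hv
  rw [AddMonoidHom.map_closure] at h
  exact h

/-- **A `Γ`-invariant `Sym⁰`-valued symbol over `ℚ_p` is bounded** (`Γ` of finite index). [cite: MazurTateTeitelbaum1986Invent, §I.8] -/
theorem exists_norm_apply_le {Γ : Subgroup SL(2, ℤ)} [Γ.FiniteIndex] {φ : P1Q → P1Q → (Fin 1 → ℚ_[p])}
    (hφ : φ ∈ (CoeffActionOn.symPowOn S 0 ℚ_[p]).Symb Γ) : ∃ C : ℝ, 0 ≤ C ∧ ∀ x y, ‖φ x y 0‖ ≤ C := by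
  haveI : Fintype (Quotient (QuotientGroup.rightRel Γ)) := Fintype.ofFinite _
  set u : Quotient (QuotientGroup.rightRel Γ) → (Fin 1 → ℚ_[p]) := fun i =>
    φ (act ((Quotient.out i : SL(2, ℤ)) : Matrix (Fin 2) (Fin 2) ℤ) infty)
      (act ((Quotient.out i : SL(2, ℤ)) : Matrix (Fin 2) (Fin 2) ℤ) (ofRat 0)) with hu
  set C : ℝ := Finset.univ.sup' ⟨Quotient.mk _ 1, Finset.mem_univ _⟩ fun i => ‖u i 0‖ with hC
  have hCi : ∀ i, ‖u i 0‖ ≤ C := fun i => Finset.le_sup' (fun i => ‖u i 0‖) (Finset.mem_univ i)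
  have hC0 : 0 ≤ C := (norm_nonneg _).trans (hCi (Quotient.mk _ 1))
  refine ⟨C, hC0, fun x y => norm_le_of_mem_closure hC0 (fun v hv => ?_) (apply_zero_mem_closure (apply_mem_closure_unimodular hφ x y))⟩
  obtain ⟨w, ⟨i, rfl⟩, rfl⟩ := hv
  exact hCi i

/-- **Integral rescaling**: a `Γ`-invariant `Sym⁰`-valued symbol over `ℚ_p` becomes `ℤ_p`-valued after
multiplication by a power of `p`. [cite: MazurTateTeitelbaum1986Invent, §I.8] -/
theorem exists_pow_mul_apply_norm_le_one {Γ : Subgroup SL(2, ℤ)} [Γ.FiniteIndex] {φ : P1Q → P1Q → (Fin 1 → ℚ_[p])}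
    (hφ : φ ∈ (CoeffActionOn.symPowOn S 0 ℚ_[p]).Symb Γ) : ∃ m : ℕ, ∀ x y i, ‖(p : ℚ_[p]) ^ m * φ x y i‖ ≤ 1 := by
  obtain ⟨C, hC0, hC⟩ := exists_norm_apply_le hφ
  have hp1 : (1 : ℝ) < p := by exact_mod_cast (Fact.out : p.Prime).one_lt
  obtain ⟨m, hm⟩ := pow_unbounded_of_one_lt C hp1
  refine ⟨m, fun x y i => ?_⟩
  have hi : ‖φ x y i‖ ≤ C := by rw [Subsingleton.elim i 0]; exact hC x y
  have hpm : (0 : ℝ) < (p : ℝ) ^ m := pow_pos (by exact_mod_cast (Fact.out : p.Prime).pos) m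
  rw [norm_mul, Padic.norm_p_pow, _root_.zpow_neg, zpow_natCast, inv_mul_le_iff₀ hpm, mul_one]
  exact hi.trans hm.le

end Bounded

/-! ### Change of scalars for `Sym⁰`-valued symbols -/

section MapZero

variable {S : Set (Matrix (Fin 2) (Fin 2) ℤ)} {R R' : Type*} [CommRing R] [CommRing R'] (σ : R →+* R')

/-- Push a `Sym⁰`-valued function of pairs of cusps along a ring homomorphism. [folklore] -/
def mapZero (φ : P1Q → P1Q → (Fin 1 → R)) : P1Q → P1Q → (Fin 1 → R') := fun x y i => σ (φ x y i)

/-- Unfolding `mapZero`. [folklore] -/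
@[simp] theorem mapZero_apply (φ : P1Q → P1Q → (Fin 1 → R)) (x y : P1Q) (i : Fin 1) : mapZero σ φ x y i = σ (φ x y i) := rfl

/-- `mapZero` is additive. [folklore] -/
theorem mapZero_add (φ ψ : P1Q → P1Q → (Fin 1 → R)) : mapZero σ (φ + ψ) = mapZero σ φ + mapZero σ ψ := by
  funext x y i; simp

/-- `mapZero` is `σ`-semilinear. [folklore] -/
theorem mapZero_smul (a : R) (φ : P1Q → P1Q → (Fin 1 → R)) : mapZero σ (a • φ) = σ a • mapZero σ φ := by
  funext x y i; simp

/-- `mapZero` of a difference. [folklore] -/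
theorem mapZero_sub (φ ψ : P1Q → P1Q → (Fin 1 → R)) : mapZero σ (φ - ψ) = mapZero σ φ - mapZero σ ψ := by
  funext x y i; simp

/-- `mapZero` of a finite sum. [folklore] -/
theorem mapZero_sum {ι : Type*} (s : Finset ι) (φ : ι → P1Q → P1Q → (Fin 1 → R)) :
    mapZero σ (∑ j ∈ s, φ j) = ∑ j ∈ s, mapZero σ (φ j) := by
  funext x y i
  simp [Finset.sum_apply, map_sum]

/-- `mapZero` commutes with the slash action of `Sym⁰`. [folklore] -/
theorem slash_mapZero (M : Matrix (Fin 2) (Fin 2) ℤ) (φ : P1Q → P1Q → (Fin 1 → R)) :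
    (CoeffActionOn.symPowOn S 0 R').slash M (mapZero σ φ) = mapZero σ ((CoeffActionOn.symPowOn S 0 R).slash M φ) := by
  funext x y i
  rw [symPowOn_zero_slash, mapZero_apply, mapZero_apply, symPowOn_zero_slash]

/-- **`mapZero` commutes with the Hecke operators.** [folklore] -/
theorem hecke_mapZero (N p : ℕ) [NeZero p] (φ : P1Q → P1Q → (Fin 1 → R)) :
    (CoeffActionOn.symPowOn S 0 R').hecke N p (mapZero σ φ) = mapZero σ ((CoeffActionOn.symPowOn S 0 R).hecke N p φ) := by
  rw [CoeffActionOn.hecke_apply, CoeffActionOn.hecke_apply, mapZero_sum]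
  exact Finset.sum_congr rfl fun i _ => slash_mapZero σ _ φ

variable {σ}

/-- `mapZero` along an injective `σ` is injective. [folklore] -/
theorem mapZero_injective (hσ : Function.Injective σ) : Function.Injective (mapZero σ) := by
  intro φ ψ h
  funext x y i
  exact hσ (congrFun (congrFun (congrFun h x) y) i)

/-- **Additivity is reflected and preserved** along an injective `σ`. [folklore] -/
theorem mapZero_mem_modSym_iff (hσ : Function.Injective σ) (φ : P1Q → P1Q → (Fin 1 → R)) :
    mapZero σ φ ∈ modSym R' (Fin 1 → R') ↔ φ ∈ modSym R (Fin 1 → R) := by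
  rw [mem_modSym_iff, mem_modSym_iff]
  refine ⟨fun h x y z => ?_, fun h x y z => ?_⟩
  · funext i
    exact hσ (by simpa using congrFun (h x y z) i)
  · funext i
    have := congrFun (h x y z) i
    simp only [Pi.add_apply] at this
    simp [← this]

/-- **Membership in `Symb_Γ(Sym⁰)` is reflected and preserved** along an injective `σ`. [folklore] -/
theorem mapZero_mem_Symb_iff (hσ : Function.Injective σ) {Γ : Subgroup SL(2, ℤ)} (φ : P1Q → P1Q → (Fin 1 → R)) :
    mapZero σ φ ∈ (CoeffActionOn.symPowOn S 0 R').Symb Γ ↔ φ ∈ (CoeffActionOn.symPowOn S 0 R).Symb Γ := by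
  rw [CoeffActionOn.mem_Symb_iff, CoeffActionOn.mem_Symb_iff, mapZero_mem_modSym_iff hσ]
  refine and_congr_right fun _ => forall_congr' fun γ => forall_congr' fun _ => ?_
  rw [slash_mapZero]
  exact (mapZero_injective hσ).eq_iff

/-- **The Hecke eigen-equations are reflected and preserved** along an injective `σ`. [folklore] -/
theorem hecke_mapZero_eq_smul_iff (hσ : Function.Injective σ) {N p : ℕ} [NeZero p] (φ : P1Q → P1Q → (Fin 1 → R)) (a : R) :
    (CoeffActionOn.symPowOn S 0 R').hecke N p (mapZero σ φ) = σ a • mapZero σ φ ↔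
      (CoeffActionOn.symPowOn S 0 R).hecke N p φ = a • φ := by
  rw [hecke_mapZero, ← mapZero_smul]
  exact (mapZero_injective hσ).eq_iff

end MapZero

end Literature.NumberTheory.EllipticCurves

end
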